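import Summits.ResolutionOfSingularities.ResolutionOfSingularities.Theorems.MarkedTransferCampaignW21MinedHypothesis
import Summits.ResolutionOfSingularities.ResolutionOfSingularities.Theorems.MarkedTransferCampaignW21ExactClass
import HarnessLib

/-!
# [OURS · L1 W2.1] MINED HYPOTHESIS #1 in the kernel: `OrderBoundTopDegreeLe p`, `MinDegreeTopIffTopDegreeLe p`,
# `DisplayedChainIffTopDegreeLe p` — PROVED for every prime `p`

Rung L (rescue) of cell res-hironaka, RESCUE-SEED row L-G2, slot W2.1, seat res-L1-s21-pv-1. Vocabulary:
`MarkedTransferCampaignW21MinedHypothesis.lean` (res-L1-type-o3, p470654): class (D) `TopDegreeLeOrder`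
(«|α + pβ + qγ₀| ≤ ord ε»), `OrderBoundTopDegreeLe p := OrderBoundOn p TopDegreeLeOrder`, the reconciliation
`MinDegreeTopIffTopDegreeLe p` ((B) `MinDegreeTop` ↔ (D) under `Standing`, `e > 0`) and the AS-PRINTED display of
Rem. 9.9 (1) read in `K⟦x⟧` on a class (`DisplayedChainOn p C`, `DisplayedChainIffTopDegreeLe p`).

THIS FILE PROVES, for every prime `p`:
* `orderBoundTopDegreeLe_holds : OrderBoundTopDegreeLe p` (all `e`) — res-L1-k21's argument for `MinDegreeTop`
  (p463892) consumes only `|α+pβ| + |qγ₀| ≤ ord ε`;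
* `minDegreeTopIffTopDegreeLe_holds : MinDegreeTopIffTopDegreeLe p` — «⇐» is `ord ε ≤ |α+pβ+qγ₀|`: the coefficient of
  `x^{α+pβ+qγ₀}` in `ε` is the constant coefficient of the unit `u₀` (`coeff_topExp_eq`), because for `e ≥ 1` the
  mixed-radix map `(a,b,c) ↦ a + pb + qc` is injective on the row-052 digit ranges (`tripleExp_injective`), the
  coefficients `u_t ∈ ρ^ℓ` are supported on `p^ℓ ℕ^n` (tree `isSupportedOnMultiples_of_exists_pow_eq`) and
  `|α+pβ+qγ₀| < p^ℓ` (`Standing.depth`);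
* `displayedChainIffTopDegreeLe_holds : DisplayedChainIffTopDegreeLe p` (all `e`) — the typed AS-PRINTED display
  `S09LLUED.Rem9_9_1` (two conjuncts «2·ord ε ≤ ord H♭ε + N» ∧ «ord ε + N ≤ 2·ord ε», `N = |α+pβ+qγ₀|`) read in `K⟦x⟧`
  holds IFF the datum is in class (D): the first conjunct is unconditional (k21's
  `two_mul_order_le_order_hasseDeriv_mul_add`), the second is `N ≤ ord ε` (cancellation in `ℕ∞`, trivial at `ord ε = ⊤`);
  hence `displayedChainOn_topDegreeLeOrder : DisplayedChainOn p TopDegreeLeOrder` and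
  `displayedChainOn_minDegreeTop : DisplayedChainOn p MinDegreeTop` — the FOLLOWS-MODULO-<class> shape of GAP row R05 /
  reading S-I, kernel-checked, for the classes (D) ⊇ (B).
Everything here is OURS / folklore; nothing is a statement of or about the manuscript under adjudication (GAP row R05:
the typed candidate `Rem9_9_1` is only quoted by name inside OURS restrictions); AI-produced formalisation, expert
review is stronger than AI review.
-/

noncomputable section

set_option linter.dupNamespace false -- mandated namespace of this single-conjunct summit

namespace Summit.ResolutionOfSingularities.ResolutionOfSingularities.Theorems

namespace CampaignW21

open Literature.AlgebraicGeometry.Hironaka2017.S08UnitMonomial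
open Literature.AlgebraicGeometry.Hironaka2017.S09LLUED
open Literature.AlgebraicGeometry.Hironaka2017.S09LLUED.TopFrontier
open Literature.AlgebraicGeometry.Resolution
open Literature.RingTheory.MvPowerSeries
open MvPowerSeries Finsupp

/-! ## 1. The order bound on class (D) (all `e`) -/

/-- Assembly: `ord (∂^{(α+pβ)}ε · ∂^{(qγ₀)}ε) ≤ ord H♭(ε)` (the leading factor `u₀⁻¹` is a unit). [folklore] -/
theorem adicOrder_mul_le_adicOrder_caseI {K : Type} [Field K] {n : ℕ} (u : (MvPowerSeries (Fin n) K)ˣ) (p q : ℕ)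
    (α β γ₀ : Fin n →₀ ℕ) (ε : MvPowerSeries (Fin n) K) :
    adicOrder (hasseDeriv (α + p • β) ε * hasseDeriv (q • γ₀) ε) ≤
      adicOrder (HFlat.caseI (hasseD K n) u p q α β γ₀ ε) := by
  show _ ≤ adicOrder ((↑u⁻¹ : MvPowerSeries (Fin n) K) * hasseD K n (α + p • β) ε * hasseD K n (q • γ₀) ε)
  have hunit : adicOrder ((↑u⁻¹ : MvPowerSeries (Fin n) K)) = 0 := adicOrder_of_isUnit (Units.isUnit _)
  have hprod := adicOrder_add_adicOrder_le_mul (↑u⁻¹ : MvPowerSeries (Fin n) K)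
    (hasseD K n (α + p • β) ε * hasseD K n (q • γ₀) ε)
  rw [hunit, zero_add, ← mul_assoc] at hprod
  exact hprod

/-- **[OURS · L1 W2.1] `OrderBoundTopDegreeLe p` HOLDS for every prime `p`** (and every `e`): on class (D)
`TopDegreeLeOrder` («|α+pβ+qγ₀| ≤ ord ε») the Case-(I) value `H♭(ε) = u₀⁻¹ ∂^{(α+pβ)}ε · ∂^{(qγ₀)}ε` has
`ord ε ≤ ord H♭(ε)` — res-L1-k21's `MinDegreeTop` argument (p463892) verbatim, which uses the class only through this
inequality. NOT a statement of the manuscript. [folklore] -/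
theorem orderBoundTopDegreeLe_holds (p : ℕ) [Fact p.Prime] : OrderBoundTopDegreeLe p := by
  intro K _ _ n e ℓ ε S h0 hS _hI hC
  have hdeg := hC h0
  refine le_trans ?_ (adicOrder_mul_le_adicOrder_caseI _ p (p ^ e) _ _ _ ε)
  rw [adicOrder_eq_order] at hdeg
  rw [adicOrder_eq_order, adicOrder_eq_order]
  exact order_le_order_hasseDeriv_mul_of_degree_le _ _ ε hdeg

/-! ## 2. Injectivity of the mixed-radix exponent map `(a, b, c) ↦ a + p·b + p^e·c` (`e ≥ 1`) -/

/-- One coordinate: for `0 < e`, `a, a' < p`, `b, b' < p^{e−1}`, `a + p b + p^e c = a' + p b' + p^e c'` forces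
`a = a'`, `b = b'`, `c = c'`. [folklore] -/
theorem mixedRadix_injective {p e : ℕ} (hp : 0 < p) (he : 0 < e) {a b c a' b' c' : ℕ} (ha : a < p) (ha' : a' < p)
    (hb : b < p ^ (e - 1)) (hb' : b' < p ^ (e - 1)) (h : a + p * b + p ^ e * c = a' + p * b' + p ^ e * c') :
    a = a' ∧ b = b' ∧ c = c' := by
  have epe : p ^ e = p * p ^ (e - 1) := by
    rw [← pow_succ']; congr 1; omega
  have h1 : a + p * (b + p ^ (e - 1) * c) = a' + p * (b' + p ^ (e - 1) * c') := by
    rw [epe] at h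
    calc a + p * (b + p ^ (e - 1) * c) = a + p * b + p * p ^ (e - 1) * c := by ring
      _ = a' + p * b' + p * p ^ (e - 1) * c' := h
      _ = a' + p * (b' + p ^ (e - 1) * c') := by ring
  have hpe : 0 < p ^ (e - 1) := Nat.pow_pos hp
  have hmod : a = a' := by
    have := congrArg (· % p) h1
    simpa only [Nat.add_mul_mod_self_left, Nat.mod_eq_of_lt ha, Nat.mod_eq_of_lt ha'] using this
  have hdiv : b + p ^ (e - 1) * c = b' + p ^ (e - 1) * c' := by
    have := congrArg (· / p) h1
    simpa only [Nat.add_mul_div_left _ _ hp, Nat.div_eq_of_lt ha, Nat.div_eq_of_lt ha', zero_add] using this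
  have hmod2 : b = b' := by
    have := congrArg (· % p ^ (e - 1)) hdiv
    simpa only [Nat.add_mul_mod_self_left, Nat.mod_eq_of_lt hb, Nat.mod_eq_of_lt hb'] using this
  have hdiv2 : c = c' := by
    have := congrArg (· / p ^ (e - 1)) hdiv
    simpa only [Nat.add_mul_div_left _ _ hpe, Nat.div_eq_of_lt hb, Nat.div_eq_of_lt hb', zero_add] using this
  exact ⟨hmod, hmod2, hdiv2⟩

/-- **Injectivity of the exponent of a row-052 term** (`e ≥ 1`): with `a_i, a'_i < p` and `b_i, b'_i < p^{e−1}`,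
`a + p•b + p^e•c = a' + p•b' + p^e•c'` forces `(a, b, c) = (a', b', c')`. [folklore] -/
theorem tripleExp_injective {p e n : ℕ} (hp : 0 < p) (he : 0 < e) {a b c a' b' c' : Fin n →₀ ℕ}
    (ha : ∀ i, a i < p) (ha' : ∀ i, a' i < p) (hb : ∀ i, b i < p ^ (e - 1)) (hb' : ∀ i, b' i < p ^ (e - 1))
    (h : a + p • b + p ^ e • c = a' + p • b' + p ^ e • c') : a = a' ∧ b = b' ∧ c = c' := by
  have hi : ∀ i, a i = a' i ∧ b i = b' i ∧ c i = c' i := by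
    intro i
    have := DFunLike.congr_fun h i
    simp only [Finsupp.add_apply, Finsupp.smul_apply, smul_eq_mul] at this
    exact mixedRadix_injective hp he (ha i) (ha' i) (hb i) (hb' i) this
  exact ⟨Finsupp.ext fun i => (hi i).1, Finsupp.ext fun i => (hi i).2.1, Finsupp.ext fun i => (hi i).2.2⟩

/-! ## 3. The coefficient of the top monomial `x^{α+pβ+qγ₀}` in `ε` -/

section TopCoeff

variable (p : ℕ) [hp : Fact p.Prime] {K : Type} [Field K] [CharP K p] {n e ℓ : ℕ}

/-- **The top monomial is met by the top term only**: for a standard expression with `0 < e` and an exponent `E` with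
`|E| < p^ℓ` that is the exponent of a term `t₀ ∈ T`, the coefficient of `x^E` in `ε` is the constant coefficient of
`u_{t₀}` (every other term `u_t x^{E_t}` has `E_t ≠ E` by injectivity, and `u_t ∈ ρ^ℓ` is supported on `p^ℓ ℕ^n`, so it
cannot reach `x^E` from `x^{E_t}` at distance `< p^ℓ`). [folklore] -/
theorem coeff_eq_constantCoeff_of_mem (he : 0 < e) {ε : MvPowerSeries (Fin n) K}
    (S : StandardExpression p (xs K n) e ℓ ε) {t₀ : ExpTriple n} (ht₀ : t₀ ∈ S.support)
    (hdepth : (t₀.1 + p • t₀.2.1 + p ^ e • t₀.2.2).degree < p ^ ℓ) :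
    coeff (t₀.1 + p • t₀.2.1 + p ^ e • t₀.2.2) ε = constantCoeff (S.u t₀) := by
  classical
  have hp0 : 0 < p := hp.out.pos
  have key : coeff (t₀.1 + p • t₀.2.1 + p ^ e • t₀.2.2) (∑ t ∈ S.support,
      ((∏ i, xs K n i ^ t.1 i) * (∏ i, xs K n i ^ (p * t.2.1 i)) * ∏ i, xs K n i ^ (p ^ e * t.2.2 i)) * S.u t) =
      constantCoeff (S.u t₀) := by
    rw [map_sum, Finset.sum_eq_single t₀]
    · rw [term_eq_monomial, coeff_monomial_mul, if_pos le_rfl, one_mul, tsub_self, coeff_zero_eq_constantCoeff]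
    · intro t ht hne
      rw [term_eq_monomial, coeff_monomial_mul]
      split_ifs with hle
      · rw [one_mul]
        obtain ⟨d, hd⟩ := exists_add_of_le hle
        have hd' : t₀.1 + p • t₀.2.1 + p ^ e • t₀.2.2 - (t.1 + p • t.2.1 + p ^ e • t.2.2) = d := by
          rw [hd, add_tsub_cancel_left]
        rw [hd']
        by_cases hd0 : d = 0
        · exfalso
          rw [hd0, add_zero] at hd
          obtain ⟨h1, h2, h3⟩ := tripleExp_injective hp0 he (S.a_lt t₀ ht₀) (S.a_lt t ht) (S.b_lt t₀ ht₀)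
            (S.b_lt t ht) hd
          exact hne (Prod.ext h1 (Prod.ext h2 h3)).symm
        · -- `d ≠ 0`, `|d| ≤ |E| < p^ℓ`: some coordinate of `d` is not a multiple of `p^ℓ`
          obtain ⟨s, hs⟩ : ∃ s, d s ≠ 0 := by
            by_contra hcon
            push Not at hcon
            exact hd0 (Finsupp.ext hcon)
          have hdle : d.degree ≤ (t₀.1 + p • t₀.2.1 + p ^ e • t₀.2.2).degree := by
            rw [hd]; exact Finsupp.degree_mono le_add_self
          have hds : d s < p ^ ℓ := lt_of_le_of_lt ((Finsupp.le_degree s d).trans hdle) hdepth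
          have hndvd : ¬ p ^ ℓ ∣ d s := fun hdvd => hs (Nat.eq_zero_of_dvd_of_lt hdvd hds)
          exact isSupportedOnMultiples_of_exists_pow_eq p (S.u_mem t ht) d ⟨s, hndvd⟩
      · rfl
    · intro h; exact absurd ht₀ h
  rwa [← S.sum_eq] at key

/-- The coefficient of the TOP monomial `x^{α+pβ+qγ₀}` in `ε` is the constant coefficient of the leading coefficient
`u₀ = u(α, β, γ₀)` (standard expression, `0 < e`, depth `|α+pβ+qγ₀| < p^ℓ`). [folklore] -/
theorem coeff_topExp_eq (he : 0 < e) {ε : MvPowerSeries (Fin n) K} (S : StandardExpression p (xs K n) e ℓ ε)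
    (h0 : 0 < frontierLength S.support S.u)
    (hdepth : (alpha S.support S.u + p • beta S.support S.u + p ^ e • gamma S.support S.u ⟨0, h0⟩).degree < p ^ ℓ) :
    coeff (alpha S.support S.u + p • beta S.support S.u + p ^ e • gamma S.support S.u ⟨0, h0⟩) ε =
      constantCoeff (S.u (alpha S.support S.u, beta S.support S.u, gamma S.support S.u ⟨0, h0⟩)) :=
  coeff_eq_constantCoeff_of_mem p he S (t₀ := (alpha S.support S.u, beta S.support S.u, gamma S.support S.u ⟨0, h0⟩))
    (gamma_mem ⟨0, h0⟩) hdepth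

/-- Under `Standing` (`u₀` a unit) and `0 < e`: `ord ε ≤ |α + pβ + qγ₀|`. [folklore] -/
theorem adicOrder_le_topDegree (he : 0 < e) {ε : MvPowerSeries (Fin n) K}
    (S : StandardExpression p (xs K n) e ℓ ε) (h0 : 0 < frontierLength S.support S.u) (hS : Standing p e ℓ ε S h0) :
    adicOrder ε ≤
      ((alpha S.support S.u + p • beta S.support S.u + p ^ e • gamma S.support S.u ⟨0, h0⟩).degree : ℕ∞) := by
  rw [adicOrder_eq_order]
  apply MvPowerSeries.order_le
  rw [coeff_topExp_eq p he S h0 hS.depth]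
  exact (isUnit_constantCoeff _ hS.unit_u0).ne_zero

end TopCoeff

/-! ## 4. The reconciliation (B) ↔ (D) -/

/-- **[OURS · L1 W2.1] `MinDegreeTopIffTopDegreeLe p` HOLDS for every prime `p`**: under `Standing` and `0 < e`, class (B)
`MinDegreeTop` («ord ε = |α+pβ+qγ₀|») and class (D) `TopDegreeLeOrder` («|α+pβ+qγ₀| ≤ ord ε») coincide — the
reconciliation owed under RESCUE-SEED v0.3 §7b row 1 (MINED HYPOTHESIS #1), kernel-checked. NOT a statement of the
manuscript. [folklore] -/
theorem minDegreeTopIffTopDegreeLe_holds (p : ℕ) [Fact p.Prime] : MinDegreeTopIffTopDegreeLe p := by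
  intro K _ _ n e ℓ he ε S h0 hS
  constructor
  · intro hB h0'
    exact le_of_eq (hB h0').symm
  · intro hD h0'
    exact le_antisymm (adicOrder_le_topDegree p he S h0' hS) (hD h0')

/-! ## 5. The AS-PRINTED display of Rem. 9.9 (1) on a class (all `e`) -/

/-- **[OURS · L1 W2.1] `DisplayedChainIffTopDegreeLe p` HOLDS for every prime `p`** (and every `e`): under `Standing` and
Case (I), the typed AS-PRINTED display `S09LLUED.Rem9_9_1` read in `K⟦x⟧` — «2·ord ε ≤ ord H♭ε + N» ∧ «ord ε + N ≤
2·ord ε», `N = |α+pβ+qγ₀|` — holds IFF `N ≤ ord ε` (class (D)). The first conjunct is unconditional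
(`2·ord f ≤ ord(Δ_α f · Δ_β f) + |α+β|`, res-L1-k21 p463892, and `ord(u₀⁻¹ g) ≥ ord g`); the second is the class
condition by cancellation in `ℕ∞` (at `ord ε = ⊤` both sides hold). Neither Case (I) nor `Standing` beyond the unit
`u₀` is used. NOT a statement of the manuscript (the typed candidate is quoted by name). [folklore] -/
theorem displayedChainIffTopDegreeLe_holds (p : ℕ) [Fact p.Prime] : DisplayedChainIffTopDegreeLe p := by
  intro K _ _ n e ℓ ε S h0 hS _hI
  -- the unconditional first conjunct
  have h1 : adicOrder ε + adicOrder ε ≤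
      adicOrder (HFlat.caseI (hasseD K n) hS.unit_u0.unit p (p ^ e)
        (alpha S.support S.u) (beta S.support S.u) (gamma S.support S.u ⟨0, h0⟩) ε) +
        ((alpha S.support S.u + p • beta S.support S.u + p ^ e • gamma S.support S.u ⟨0, h0⟩).degree : ℕ∞) := by
    have h2 := two_mul_order_le_order_hasseDeriv_mul_add
      (alpha S.support S.u + p • beta S.support S.u) (p ^ e • gamma S.support S.u ⟨0, h0⟩) ε
    rw [two_mul, ← adicOrder_eq_order ε, ← adicOrder_eq_order (hasseDeriv _ ε * hasseDeriv _ ε)] at h2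
    exact h2.trans (add_le_add (adicOrder_mul_le_adicOrder_caseI _ p (p ^ e) _ _ _ ε) le_rfl)
  constructor
  · rintro ⟨-, h⟩ h0'
    -- `ord ε + N ≤ ord ε + ord ε` ⇒ `N ≤ ord ε`
    induction hO : adicOrder ε using ENat.recTopCoe with
    | top => exact le_top
    | coe m =>
      rw [hO] at h
      have h' : ((m + (alpha S.support S.u + p • beta S.support S.u +
          p ^ e • gamma S.support S.u ⟨0, h0⟩).degree : ℕ) : ℕ∞) ≤ ((m + m : ℕ) : ℕ∞) := by
        exact_mod_cast h
      exact_mod_cast (by have := Nat.cast_le.mp h'; omega :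
        (alpha S.support S.u + p • beta S.support S.u + p ^ e • gamma S.support S.u ⟨0, h0⟩).degree ≤ m)
  · intro hD
    exact ⟨h1, by rw [add_comm]; exact add_le_add (hD h0) le_rfl⟩

/-- **[OURS · L1 W2.1] `DisplayedChainOn p TopDegreeLeOrder`**: the AS-PRINTED display of Rem. 9.9 (1), read in
`K⟦x⟧`, HOLDS on class (D) — the FOLLOWS-MODULO-<TopDegreeLeOrder> shape for GAP row R05 / reading S-I, for every
prime `p` and every `e`. NOT a statement of the manuscript. [folklore] -/
theorem displayedChainOn_topDegreeLeOrder (p : ℕ) [Fact p.Prime] : DisplayedChainOn p TopDegreeLeOrder :=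
  fun K _ _ n e ℓ ε S h0 hS hI hC => (displayedChainIffTopDegreeLe_holds p K n e ℓ ε S h0 hS hI).2 hC

/-- **[OURS · L1 W2.1] `DisplayedChainOn p MinDegreeTop`**: the AS-PRINTED display of Rem. 9.9 (1), read in `K⟦x⟧`,
HOLDS on class (B) (`MinDegreeTop ⊆ TopDegreeLeOrder` trivially), every prime `p`, every `e`. NOT a statement of the
manuscript. [folklore] -/
theorem displayedChainOn_minDegreeTop (p : ℕ) [Fact p.Prime] : DisplayedChainOn p MinDegreeTop :=
  fun K _ _ n e ℓ ε S h0 hS hI hC =>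
    (displayedChainIffTopDegreeLe_holds p K n e ℓ ε S h0 hS hI).2 fun h0' => le_of_eq (hC h0').symm

end CampaignW21

end Summit.ResolutionOfSingularities.ResolutionOfSingularities.Theorems

end
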